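import Literature.AnabelianGeometry.EtaleTheta.ThetaCovers

/-!
# Supplementary axioms for the theta coverings and Remark 2.1.1 ([EtTh] §2, pp.35–37)

Mochizuki, *The Étale Theta Function …* [EtTh], Publ. RIMS 45 (2009), §2 (bib key
`MochizukiEtTh2009`; locators = PDF pages of the PRIMS text). `CoverDataAx` extends
`ThetaCovers.CoverData` (file `ThetaCovers.lean`) by two printed facts not carried there: `Δ̄_X` is the
quotient of `Δ^Θ_X` "by the subgroup generated by `l`-th powers" (p.35) — exponent dividing `l`; and
the inversion acts by `−1` on `Δ̄^ell_X` ("`ι` acts on `Q` by multiplication by `−1`", Rmk 2.1.1 p.36)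
and by `+1` on `Δ̄_Θ` ("eigenvalues `−1` and `1`", Prop 2.2 (i) p.37). From them Remark 2.1.1
(`C̲ → C` is not Galois: `N_{Π_C}(Π_{C̲}) ∩ Π_X = Π_{X̲}`) is DISCHARGED (`CoverDataAx.rmk211_holds`).
-/

namespace Literature.AnabelianGeometry.EtaleTheta

namespace ThetaCovers

universe u

/-- **Interface supplement (pp.35–37)**: two printed facts about `CoverData` used by Prop 2.2 that
are recorded here rather than in `CoverData` itself: `Δ̄_X` is the quotient of `Δ^Θ_X` "by the
subgroup generated by `l`-th powers" (p.35) — so `Δ̄_X` has exponent dividing `l`; and the inversion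
acts on `Δ̄^ell_X` by `−1` ("`ι` acts on `Q` by multiplication by `−1`", Rmk 2.1.1, p.36) and on
`Δ̄_Θ` by `+1` ("eigenvalues `−1` and `1`, respectively", Prop 2.2 (i), p.37).
[cite: MochizukiEtTh2009, Prop 2.2(i) p.37] -/
structure CoverDataAx (l : ℕ) extends CoverData.{u} l where
  /-- `Δ̄_X = Δ^Θ_X / ⟨l-th powers⟩`: `d^l ∈ Ker(Δ_X ↠ Δ̄_X)` for `d ∈ Δ_X` (p.35) -/
  pow_mem_barKer : ∀ d ∈ PiX ⊓ aug.ker, d ^ l ∈ barKer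
  /-- an element of `Δ_C ∖ Δ_X` acts on `Δ̄^ell_X` by `−1` (Rmk 2.1.1, p.36) -/
  inv_ell : ∀ c ∈ aug.ker, c ∉ PiX → ∀ d ∈ PiX ⊓ aug.ker, c * d * c⁻¹ * d ∈ barTheta
  /-- … and on `Δ̄_Θ` by `+1` (Prop 2.2 (i), p.37) -/
  inv_theta : ∀ c ∈ aug.ker, c ∉ PiX → ∀ t ∈ barTheta, c * t * c⁻¹ * t⁻¹ ∈ barKer

/-- **Remark 2.1.1 DISCHARGED** over `CoverDataAx` (`l` odd): "no nontrivial automorphism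
`∈ Gal(X̲/X)` of odd order descends to an automorphism of `C̲^log` over `C^log`", i.e.
`N_{Π_C}(Π_{C̲}) ∩ Π_X = Π_{X̲}` — because the inversion acts on `Q` by `−1`.
[cite: MochizukiEtTh2009, Rmk 2.1.1 p.36] -/
theorem CoverDataAx.rmk211_holds {l : ℕ} (X : CoverDataAx.{u} l) : X.toCoverData.Rmk211 := by
  intro H' hH'
  haveI := X.PiX_normal
  haveI := X.barTheta_normal
  haveI : X.DeltaX.Normal := inferInstance
  have hT := hH'.inf_isTypeLTors
  refine le_antisymm ?_ (inf_le_inf_right _ Subgroup.le_normalizer)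
  rintro g ⟨hgN, hgX⟩
  refine ⟨?_, hgX⟩
  obtain ⟨φ, hφs, hφk⟩ := hT.quot
  -- an inversion `c ∈ Π_{C̲} ∩ Δ_C ∖ Π_X`
  have hne : ¬ H' ≤ H' ⊓ X.PiX := by
    intro hle
    have := Subgroup.relIndex_eq_one.mpr hle
    rw [hH'.relIndex_two] at this
    exact absurd this (by norm_num)
  obtain ⟨c₀, hc₀, hc₀X⟩ : ∃ c ∈ H', c ∉ X.PiX := by
    obtain ⟨c, hc, hc'⟩ := SetLike.not_le_iff_exists.mp hne
    exact ⟨c, hc, fun h => hc' ⟨hc, h⟩⟩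
  obtain ⟨⟨x, hx⟩, hxa⟩ := X.aug_PiX_surjective (X.aug c₀)
  have hxa : X.aug x = X.aug c₀ := hxa
  have hx' : x ∈ (H' ⊓ X.PiX) ⊔ X.DeltaX := by rw [hT.delta_sup]; exact hx
  obtain ⟨h, hh, d₀, hd₀, rfl⟩ := Subgroup.mem_sup_of_normal_right.mp hx'
  set c := h⁻¹ * c₀ with hc
  have hcH' : c ∈ H' := Subgroup.mul_mem _ (Subgroup.inv_mem _ hh.1) hc₀
  have hcX : c ∉ X.PiX := fun hcX =>
    hc₀X (by simpa [hc] using Subgroup.mul_mem _ hh.2 hcX)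
  have hcΔ : c ∈ X.aug.ker := by
    rw [MonoidHom.mem_ker, hc, map_mul, map_inv, ← hxa, map_mul, hd₀.2, mul_one, inv_mul_cancel]
  -- `u := c⁻¹ (g c g⁻¹) ∈ Π_{C̲} ∩ Π_X = Π_{X̲}`
  have hgcg : g * c * g⁻¹ ∈ H' := (Subgroup.mem_normalizer_iff.mp hgN c).mp hcH'
  have hgcgX : g * c * g⁻¹ ∉ X.PiX := fun h1 =>
    hcX (by simpa [mul_assoc] using X.PiX_normal.conj_mem _ h1 g⁻¹)
  have hu : c⁻¹ * (g * c * g⁻¹) ∈ H' ⊓ X.PiX :=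
    ⟨Subgroup.mul_mem _ (Subgroup.inv_mem _ hcH') hgcg,
      (Subgroup.mul_mem_iff_of_index_two X.index_PiX).mpr
        ⟨fun h1 => absurd (inv_mem_iff.mp h1) hcX, fun h1 => absurd h1 hgcgX⟩⟩
  -- write `g = h₁ d` with `d ∈ Δ_X`; the inversion inverts `d` modulo `Π_{X̲}`
  have hg' : g ∈ (H' ⊓ X.PiX) ⊔ X.DeltaX := by rw [hT.delta_sup]; exact hgX
  obtain ⟨h₁, hh₁, d, hd, rfl⟩ := Subgroup.mem_sup_of_normal_right.mp hg'
  have hinv : c⁻¹ * d * c * d ∈ H' ⊓ X.PiX :=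
    hT.barTheta_le (by
      have := X.inv_ell c⁻¹ (Subgroup.inv_mem _ hcΔ) (fun h1 => hcX (inv_mem_iff.mp h1)) d hd
      simpa using this)
  have hconjH : c⁻¹ * h₁ * c ∈ H' ⊓ X.PiX :=
    ⟨by simpa [mul_assoc] using Subgroup.mul_mem _ (Subgroup.mul_mem _ (Subgroup.inv_mem _ hcH') hh₁.1) hcH',
      by simpa using X.PiX_normal.conj_mem _ hh₁.2 c⁻¹⟩
  -- evaluate `φ` along the conjugation automorphism `κ = conj(c⁻¹)` of `Π_X`
  have hφH : ∀ y : ↥X.PiX, (y : X.PiC) ∈ H' ⊓ X.PiX → φ y = 1 := fun y hy => (hφk y).mpr hy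
  let κ : MulAut ↥X.PiX := MulAut.conjNormal (c⁻¹)
  have hκ : ∀ y : ↥X.PiX, ((κ y : ↥X.PiX) : X.PiC) = c⁻¹ * y * c := fun y => by
    simp [κ]
  set dP : ↥X.PiX := ⟨d, hd.1⟩
  set hP : ↥X.PiX := ⟨h₁, hh₁.2⟩
  have e_h : φ (κ hP) = 1 := hφH _ (by rw [hκ]; exact hconjH)
  have e_hP : φ hP = 1 := hφH _ hh₁
  have e_d : φ (κ dP) * φ dP = 1 := by
    rw [← map_mul]
    refine hφH _ ?_
    rw [Subgroup.coe_mul, hκ]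
    exact hinv
  have e_u : φ (κ (hP * dP) * (hP * dP)⁻¹) = 1 := by
    refine hφH _ ?_
    rw [Subgroup.coe_mul, Subgroup.coe_inv, hκ, Subgroup.coe_mul]
    simpa [mul_assoc] using hu
  have key : φ dP * φ dP = 1 := by
    have e4 : φ (κ dP) * (φ dP)⁻¹ = 1 := by
      have := e_u
      simp only [map_mul, map_inv, e_h, e_hP, one_mul] at this
      exact this
    have e5 : φ (κ dP) = φ dP := by
      rwa [mul_inv_eq_one] at e4
    rw [e5] at e_d
    exact e_d
  -- `l` odd: `a + a = 0` in `ℤ/lℤ` forces `a = 0`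
  have hd1 : φ dP = 1 := by
    have h2 : IsUnit (2 : ZMod l) := by
      have := (ZMod.isUnit_iff_coprime 2 l).mpr (Nat.coprime_two_left.mpr X.l_odd)
      exact_mod_cast this
    have : (2 : ZMod l) * (φ dP).toAdd = 0 := by
      rw [two_mul, ← toAdd_mul, key, toAdd_one]
    have h0 : (φ dP).toAdd = 0 := (h2.mul_right_eq_zero).mp this
    exact toAdd_eq_zero.mp h0
  have hdH : d ∈ H' ⊓ X.PiX := (hφk dP).mp hd1
  exact Subgroup.mul_mem _ hh₁.1 hdH.1

end ThetaCovers

end Literature.AnabelianGeometry.EtaleTheta
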